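import Literature.MathematicalPhysics.QuantumFieldTheory.Balaban1983to89.B10StarCount
import Literature.MathematicalPhysics.QuantumFieldTheory.Balaban1983to89.B14Eq22Determines
import Literature.MathematicalPhysics.QuantumFieldTheory.Balaban1983to89.B12SmallFieldDomain259
import HarnessLib

/-!
# S2β · AVG₂♭-ax_q, THE SUP CHAIN — TOP-JENSEN's LATTICE HALF, FILE A: THE FACE FOREST OF THE BLOCK AVERAGING
# (crossing dichotomy; `L^{d−1}` face bonds per coarse bond; the parent map `π` with constant fibre card — the `hcard` of ✓p830761
# `…TopChordJensen.sum_sq_le_of_mean_children`; the `n`-level tube `(L^{d−1})^n` and its recursion; the tubes partition the crossing bonds)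

Cell `ym3-torus` (YM ladder rung R3 = continuum `SU(2)` Yang–Mills on the three-torus at fixed lattice data — a RUNG: NOT d = 4, NOT infinite volume,
NOT a mass gap, NOT Clay).  Width seat «width 20» `ym3-torus-px20` (gen 24), FREE px helper on crux `stmt-QuantumFields-20520`
(`…Theses.UnitScaleTilt.FluctuationComparisonRegPrIntL`), LINE g18-1 S2β, the (ST) sup chain of px17 g22 (✓p830137 ∕ ✓p830683 `supTower_of_liftLadder₃`:
GAP♯∘ ⟸ {h3, (D-stage)×2, (TOP-LAD) ∧ (LIFT-LAD) ∧ (SCT₁) ∧ (SCT₂) ∧ (SCT₃)}).  The `c₃` (TOP∕FACE-Jensen) row of that split (px20 g23 17:51:05Z design «c₀ = (B) + FACE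
term; `E_J` paid by TOP-JENSEN», abstract spine ✓p830761 `…S2BetaTopChordJensen`, author px20 g23 ∕ filer px5 g23) instantiates the spine on the FACE FOREST of the
(0.4) block averaging: roots = the level-`J` bonds `B`, nodes `n` levels down = the finer bonds crossing the face of `B`, children of a node = the `L^{d−1}`
bonds one level finer crossing ITS face, leaves = the `N^{d−1}` finest bonds under the face (`N = L^{K−J}`).  This file is the LATTICE BOOKKEEPING of that forest
on the tree's torus (`Setup.blockOf`, lit `B10StarCount.blockOf_shift` ∕ `card_block_filter_top`, `B14.Eq22Determines.blockIter`, `B12SmallFieldDomain259.src_ne_tgt`), asked for by px5 g23 18:16:51Z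
«NEEDED — the shape the c₃ row consumes is EXACTLY the spine's: per level a parent map `π` on a Fintype (subtype of `PBond`) with CONSTANT fibre card `L^{d−1}`
in the `(univ.filter fun j => π j = i).card = c` spelling, the `k`-level tube for the `(c⁻¹)^m·E m` leaf term against `Σ_ℓ ‖ζ ℓ‖²` via the partition letter».
`--kind proof --supports stmt-QuantumFields-20520 --as helper`, count-neutral, DEFINITION-FREE (0 `def`, 0 `instance`, 0 `notation`, 0 `sorry`), default
heartbeats; generic `P : Params` (any `d ≥ 1`, odd `L > 1`), fine index `j` (finest `0`), standing range `j + 1 ≤ m + K` where blocks are used.  Sequel (FILE B,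
`…S2BetaFaceTubeRuns`): the straight RUNS of (0.4) (each crosses the face exactly once; each face bond carries `L` runs per ordering pair, px17 g22 18:22:11Z
LOCATE «index over `(x, σ, σ′)`») and the Jensen leaf term `Σ_B (N_f⁻¹ Σ_{tube} w)² ≤ N_f⁻¹ Σ_ℓ w²`.

WHAT IS PROVED (sorry-free; every «face set» ∕ «tube» is an INLINE `Finset.filter`, no definition is introduced).
* §1 ★`blockOf_tgt_eq_or` — THE CROSSING DICHOTOMY `blockOf ℓ₊ = blockOf ℓ₋ ∨ blockOf ℓ₊ = blockOf ℓ₋ + e_{dir ℓ}`;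
  `blockOf_tgt_eq_shift_iff` ∕ `blockOf_tgt_eq_iff` (crossing iff `ℓ₋` on the far layer, label `≡ L − 1 (mod L)`).
* §2 `mem_face_iff`; ★`card_face` — `#{ℓ : PBond P j | dir ℓ = dir b ∧ blockOf ℓ₋ = b₋ ∧ blockOf ℓ₊ = b₊} = L^{d−1}`; `card_parent_fibre` — `#{ℓ | dir ℓ = dir b ∧ blockOf ℓ₋ = b₋} = L^d`.
* §2b the spine's `π` ON SUBTYPES: nodes `{b : PBond P (j+1) // Q b}` for ANY marking `Q` (e.g. «under the top face»), children `{ℓ : PBond P j // ℓ crosses ∧ Q ⟨blockOf ℓ₋, dir ℓ⟩}`,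
  `π ℓ = ⟨⟨blockOf ℓ₋, dir ℓ⟩, _⟩`: `parent_eq_iff` (`π ℓ = i ↔ dir ∧ blockOf`, the decidable spelling — bridge by `Finset.filter_congr` under `classical`),
  ★★`card_children` (fibre card `= L^{d−1}`, the spine's `hcard`), `sum_children_eq_sum_face` (the spine's `hrec` sum read on the face bonds).
* §3 tubes from the finest lattice: `blockIter_tgt_eq_or`, `blockIter_tgt_eq_shift_of_succ`, `eq_of_mem_tube`, ★★`mem_tube_succ_iff` (forest recursion), ★★`sum_tube_succ`
  (`Σ_{tube_{n+1}(B)} = Σ_{b ∈ face(B)} Σ_{tube_n(b)}`), ★★`card_tube` (`#tube_n(B) = (L^{d−1})^n`).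
* §4 ★`sum_sum_tube_eq` (the tubes over all roots partition the bonds crossing a face `n` levels up), `sum_sum_tube_le` (`Σ_B Σ_{tube_n(B)} g ≤ Σ_ℓ g` for `g ≥ 0`).

HONEST SCOPE.  Finite torus combinatorics of the tree's own block map; no group, no analysis, no measure; nothing of Bałaban's is asserted or proved; the NON-ABELIAN
face∕run-mean identity (px17 g22's (O3)), (TOP-LAD)∕(LIFT-LAD)∕(SCT₁₂₃)∕(ST′)∕(ST)∕LOC, GAP♯∘ (`stub_uniformFibreGapOrbit`; registry 3732b7df UNTOUCHED, 0∕5), the five REGISTERED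
stubs, S2β, crux 20520, 19936, 19200 and `YM3TorusSU2` are NOT proved; no summit statement is proved by a helper; rung R3 = SU(2) YM₃ on T³ at fixed lattice data —
NOT d = 4, NOT infinite volume, NOT a mass gap, NOT Clay; the Yang–Mills mass gap is NOT proved.  Axioms standard.

References: T. Bałaban, CMP **109** (1987) 249–301 [Balaban1987RG1] ((0.1), (0.3)–(0.4) pp.251–253: the tori, the blocks `B(y)`, the straight segment of the
averaging contour); CMP **98** (1985) 17–51 [Balaban1985Averaging] ((2)–(3) p.17 blocks of order `j`; Prop. 4 (128)–(135) pp.37–38).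
-/

set_option autoImplicit false

open Finset

namespace Summit.QuantumFields.YangMills.Theorems.FluctuationComparisonRegPrIntLS2BetaFaceTubeCounts

open Literature.MathematicalPhysics.QuantumFieldTheory.Balaban1983to89
open Literature.MathematicalPhysics.QuantumFieldTheory.Balaban1983to89.B10StarCount (blockOf_shift shift_apply_self card_block_filter_top)
open Literature.MathematicalPhysics.QuantumFieldTheory.Balaban1983to89.B14.Eq22Determines (blockIter blockIter_zero blockIter_succ)
open Literature.MathematicalPhysics.QuantumFieldTheory.Balaban1983to89.B12SmallFieldDomain259 (src_ne_tgt)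

variable {P : Params} {j : ℕ}

/-! ## §1 The crossing dichotomy -/

/-- **THE CROSSING DICHOTOMY**: the block of the final point of a fine bond is either the block of its initial point or the next block in the
bond's direction (standing range). [cite: Balaban1987RG1, (0.3) p.252] -/
theorem blockOf_tgt_eq_or (hj : j + 1 ≤ P.m + P.K) (ℓ : PBond P j) :
    blockOf ℓ.tgt = blockOf ℓ.src ∨ blockOf ℓ.tgt = (blockOf ℓ.src).shift ℓ.dir := by
  rw [PBond.tgt, blockOf_shift hj]
  split_ifs with h
  · exact Or.inr rfl
  · exact Or.inl rfl

/-- A fine bond CROSSES into the next block iff its initial point lies on the far layer of its block in the bond's direction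
(label `≡ L − 1 (mod L)`). [cite: Balaban1987RG1, (0.3) p.252] -/
theorem blockOf_tgt_eq_shift_iff (hj : j + 1 ≤ P.m + P.K) (ℓ : PBond P j) :
    blockOf ℓ.tgt = (blockOf ℓ.src).shift ℓ.dir ↔ (ℓ.src ℓ.dir).val % P.L + 1 = P.L := by
  rw [PBond.tgt, blockOf_shift hj]
  split_ifs with h
  · simp [h]
  · simp only [h, iff_false]
    exact fun h' => src_ne_tgt ⟨blockOf ℓ.src, ℓ.dir⟩ h'

/-- A fine bond does NOT cross iff its initial point is not on the far layer. [cite: Balaban1987RG1, (0.3) p.252] -/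
theorem blockOf_tgt_eq_iff (hj : j + 1 ≤ P.m + P.K) (ℓ : PBond P j) :
    blockOf ℓ.tgt = blockOf ℓ.src ↔ ¬ ((ℓ.src ℓ.dir).val % P.L + 1 = P.L) := by
  rw [← blockOf_tgt_eq_shift_iff hj]
  constructor
  · intro h h'
    exact src_ne_tgt ⟨blockOf ℓ.src, ℓ.dir⟩ (h.symm.trans h')
  · intro h
    exact (blockOf_tgt_eq_or hj ℓ).resolve_right h

/-! ## §2 One level: the face bonds of a coarse bond (`L^{d-1}` of them) and the fibres of the parent map (`L^d`) -/

/-- Membership in the face set of a coarse bond `b`, read on the initial point: direction `b.dir`, initial point in `B(b₋)`, on the far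
`b.dir`-layer. [cite: Balaban1987RG1, (0.3) p.252] -/
theorem mem_face_iff (hj : j + 1 ≤ P.m + P.K) (b : PBond P (j + 1)) (ℓ : PBond P j) :
    (ℓ.dir = b.dir ∧ blockOf ℓ.src = b.src ∧ blockOf ℓ.tgt = b.tgt) ↔
      (ℓ.dir = b.dir ∧ blockOf ℓ.src = b.src ∧ (ℓ.src ℓ.dir).val % P.L + 1 = P.L) := by
  constructor
  · rintro ⟨hd, hs, ht⟩
    refine ⟨hd, hs, (blockOf_tgt_eq_shift_iff hj ℓ).1 ?_⟩
    rw [ht, hs, PBond.tgt, hd]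
  · rintro ⟨hd, hs, htop⟩
    refine ⟨hd, hs, ?_⟩
    rw [(blockOf_tgt_eq_shift_iff hj ℓ).2 htop, hs, PBond.tgt, hd]

/-- ★ **THE FACE OF A COARSE BOND IS CROSSED BY EXACTLY `L^{d−1}` FINE BONDS** (`L²` at `d = 3`): the fine bonds `ℓ` of direction `b.dir` with
`blockOf ℓ₋ = b₋` and `blockOf ℓ₊ = b₊`. [cite: Balaban1987RG1, (0.3) p.252] -/
theorem card_face (hj : j + 1 ≤ P.m + P.K) (b : PBond P (j + 1)) :
    (univ.filter fun ℓ : PBond P j => ℓ.dir = b.dir ∧ blockOf ℓ.src = b.src ∧ blockOf ℓ.tgt = b.tgt).card = P.L ^ (P.d - 1) := by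
  classical
  rw [← card_block_filter_top hj b.src b.dir]
  -- the face set is the image of the far layer of `B(b₋)` under `x ↦ ⟨x, b.dir⟩`
  have himg : (univ.filter fun ℓ : PBond P j => ℓ.dir = b.dir ∧ blockOf ℓ.src = b.src ∧ blockOf ℓ.tgt = b.tgt) =
      ((block b.src).filter (fun x => (x b.dir).val % P.L + 1 = P.L)).image (fun x => (⟨x, b.dir⟩ : PBond P j)) := by
    ext ℓ
    simp only [mem_filter, mem_univ, true_and, mem_image, block]
    rw [mem_face_iff hj]
    constructor
    · rintro ⟨hd, hs, htop⟩
      refine ⟨ℓ.src, ⟨hs, ?_⟩, ?_⟩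
      · rw [← hd]; exact htop
      · cases ℓ; simp only at hd; subst hd; rfl
    · rintro ⟨x, ⟨hs, htop⟩, rfl⟩
      exact ⟨rfl, hs, htop⟩
  rw [himg, card_image_of_injective]
  intro x x' h
  exact congrArg PBond.src h

/-- THE FIBRES OF THE PARENT MAP `ℓ ↦ ⟨blockOf ℓ₋, dir ℓ⟩`: a coarse bond `b` has exactly `L^d` fine bonds of its direction starting in `B(b₋)`.
[cite: Balaban1987RG1, (0.3) p.252] -/
theorem card_parent_fibre (hj : j + 1 ≤ P.m + P.K) (b : PBond P (j + 1)) :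
    (univ.filter fun ℓ : PBond P j => ℓ.dir = b.dir ∧ blockOf ℓ.src = b.src).card = P.L ^ P.d := by
  classical
  rw [← Site.card_block hj b.src]
  have himg : (univ.filter fun ℓ : PBond P j => ℓ.dir = b.dir ∧ blockOf ℓ.src = b.src) =
      (block b.src).image (fun x => (⟨x, b.dir⟩ : PBond P j)) := by
    ext ℓ
    simp only [mem_filter, mem_univ, true_and, mem_image, block]
    constructor
    · rintro ⟨hd, hs⟩
      refine ⟨ℓ.src, hs, ?_⟩
      cases ℓ; simp only at hd; subst hd; rfl
    · rintro ⟨x, hs, rfl⟩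
      exact ⟨rfl, hs⟩
  rw [himg, card_image_of_injective]
  intro x x' h
  exact congrArg PBond.src h

/-! ## §2b The parent map of the face forest as a function on subtypes (the spine's `π`, constant fibre card `L^{d−1}`) -/

/-- THE SPINE's `π j = i` READ DECIDABLY: for `Q`-marked coarse bonds `i` and crossing fine bonds `ℓ` whose parent is `Q`-marked, «parent of `ℓ` = `i`» iff
«same direction and `blockOf ℓ₋ = i₋`» (use under `classical` with `Finset.filter_congr` to pass between the two spellings). [folklore] -/
theorem parent_eq_iff {Q : PBond P (j + 1) → Prop} (i : {b : PBond P (j + 1) // Q b})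
    (ℓ : {ℓ : PBond P j // blockOf ℓ.tgt = (blockOf ℓ.src).shift ℓ.dir ∧ Q ⟨blockOf ℓ.src, ℓ.dir⟩}) :
    (⟨⟨blockOf ℓ.1.src, ℓ.1.dir⟩, ℓ.2.2⟩ : {b : PBond P (j + 1) // Q b}) = i ↔ (ℓ.1.dir = i.1.dir ∧ blockOf ℓ.1.src = i.1.src) := by
  obtain ⟨⟨isrc, idir⟩, hi⟩ := i
  rw [Subtype.mk.injEq]
  constructor
  · intro h; cases h; exact ⟨rfl, rfl⟩
  · rintro ⟨hd, hs⟩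
    simp only at hd hs
    subst hd; subst hs; rfl

/-- ★★ **THE SPINE's `hcard`: EVERY NODE HAS EXACTLY `L^{d−1}` CHILDREN.**  Nodes `ι = {b : PBond P (j+1) // Q b}` (any marking `Q`, e.g. «lies under the top face»),
children `κ = {ℓ : PBond P j // ℓ crosses ∧ Q (parent ℓ)}`, parent `π ℓ = ⟨⟨blockOf ℓ₋, dir ℓ⟩, _⟩`; the fibre of `i` (in the decidable spelling of
✓`parent_eq_iff`) has `L^{d−1}` elements (✓`card_face` transported along `Subtype.val`). [cite: Balaban1987RG1, (0.3) p.252] -/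
theorem card_children {Q : PBond P (j + 1) → Prop} [DecidablePred Q] (hj : j + 1 ≤ P.m + P.K) (i : {b : PBond P (j + 1) // Q b}) :
    (univ.filter fun ℓ : {ℓ : PBond P j // blockOf ℓ.tgt = (blockOf ℓ.src).shift ℓ.dir ∧ Q ⟨blockOf ℓ.src, ℓ.dir⟩} =>
        ℓ.1.dir = i.1.dir ∧ blockOf ℓ.1.src = i.1.src).card = P.L ^ (P.d - 1) := by
  classical
  rw [← card_face hj i.1, ← card_image_of_injective _ Subtype.val_injective]
  congr 1
  ext ℓ
  simp only [mem_image, mem_filter, mem_univ, true_and]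
  constructor
  · rintro ⟨ℓ', ⟨hd, hs⟩, rfl⟩
    refine ⟨hd, hs, ?_⟩
    rw [ℓ'.2.1, hs, hd]; rfl
  · rintro ⟨hd, hs, ht⟩
    have hcross : blockOf ℓ.tgt = (blockOf ℓ.src).shift ℓ.dir := by rw [ht, hs, hd]; rfl
    have hQ : Q ⟨blockOf ℓ.src, ℓ.dir⟩ := by rw [hs, hd]; exact i.2
    exact ⟨⟨ℓ, hcross, hQ⟩, ⟨hd, hs⟩, rfl⟩

/-- THE SPINE's `hrec` SUM READ ON THE LATTICE: a sum over the children of `i` (fibre of `π`) of a function of the underlying bond is the sum over the face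
bonds of `i`. [cite: Balaban1987RG1, (0.3) p.252] -/
theorem sum_children_eq_sum_face {M : Type*} [AddCommMonoid M] {Q : PBond P (j + 1) → Prop} [DecidablePred Q] (hj : j + 1 ≤ P.m + P.K)
    (i : {b : PBond P (j + 1) // Q b}) (w : PBond P j → M) :
    ∑ ℓ ∈ univ.filter (fun ℓ : {ℓ : PBond P j // blockOf ℓ.tgt = (blockOf ℓ.src).shift ℓ.dir ∧ Q ⟨blockOf ℓ.src, ℓ.dir⟩} =>
        ℓ.1.dir = i.1.dir ∧ blockOf ℓ.1.src = i.1.src), w ℓ.1 =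
      ∑ f ∈ univ.filter (fun ℓ : PBond P j => ℓ.dir = i.1.dir ∧ blockOf ℓ.src = i.1.src ∧ blockOf ℓ.tgt = i.1.tgt), w f := by
  classical
  have _ := hj
  rw [← Finset.sum_image (g := Subtype.val) (f := w) (fun x _ y _ h => Subtype.val_injective h)]
  refine Finset.sum_congr ?_ fun _ _ => rfl
  ext ℓ
  simp only [mem_image, mem_filter, mem_univ, true_and]
  constructor
  · rintro ⟨ℓ', ⟨hd, hs⟩, rfl⟩
    refine ⟨hd, hs, ?_⟩
    rw [ℓ'.2.1, hs, hd]; rfl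
  · rintro ⟨hd, hs, ht⟩
    have hcross : blockOf ℓ.tgt = (blockOf ℓ.src).shift ℓ.dir := by rw [ht, hs, hd]; rfl
    have hQ : Q ⟨blockOf ℓ.src, ℓ.dir⟩ := by rw [hs, hd]; exact i.2
    exact ⟨⟨ℓ, hcross, hQ⟩, ⟨hd, hs⟩, rfl⟩

/-! ## §3 The tube under a bond `n` levels up, read from the finest lattice (`blockIter`): recursion over the face forest -/

/-- The crossing dichotomy `n` levels up. [cite: Balaban1987RG1, (0.3) p.252] -/
theorem blockIter_tgt_eq_or : ∀ (n : ℕ), n ≤ P.m + P.K → ∀ ℓ : PBond P 0,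
    blockIter n ℓ.tgt = blockIter n ℓ.src ∨ blockIter n ℓ.tgt = (blockIter n ℓ.src).shift ℓ.dir
  | 0, _, _ => Or.inr rfl
  | n + 1, hn, ℓ => by
    rcases blockIter_tgt_eq_or n (Nat.le_of_succ_le hn) ℓ with h | h
    · exact Or.inl (by rw [blockIter_succ, blockIter_succ, h])
    · rw [blockIter_succ, blockIter_succ, h]
      exact blockOf_tgt_eq_or hn ⟨blockIter n ℓ.src, ℓ.dir⟩

/-- A fine bond that crosses a face `n + 1` levels up crosses a face `n` levels up. [cite: Balaban1987RG1, (0.3) p.252] -/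
theorem blockIter_tgt_eq_shift_of_succ (n : ℕ) (hn : n + 1 ≤ P.m + P.K) (ℓ : PBond P 0)
    (h : blockIter (n + 1) ℓ.tgt = (blockIter (n + 1) ℓ.src).shift ℓ.dir) :
    blockIter n ℓ.tgt = (blockIter n ℓ.src).shift ℓ.dir := by
  rcases blockIter_tgt_eq_or n (Nat.le_of_succ_le hn) ℓ with h' | h'
  · exfalso
    rw [blockIter_succ, blockIter_succ, h'] at h
    exact src_ne_tgt ⟨blockOf (blockIter n ℓ.src), ℓ.dir⟩ h
  · exact h'

/-- The node of the face forest `n` levels up through which a tube bond passes is `⟨blockIter n ℓ₋, dir ℓ⟩`. [cite: Balaban1987RG1, (0.3) p.252] -/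
theorem eq_of_mem_tube {n : ℕ} {b : PBond P n} {ℓ : PBond P 0}
    (h : ℓ.dir = b.dir ∧ blockIter n ℓ.src = b.src ∧ blockIter n ℓ.tgt = b.tgt) : b = ⟨blockIter n ℓ.src, ℓ.dir⟩ := by
  obtain ⟨hd, hs, -⟩ := h
  cases b
  simp only at hd hs
  subst hd
  subst hs
  rfl

/-- ★★ **THE FOREST RECURSION**: a finest bond lies in the tube of `B` (`n + 1` levels up) iff it lies in the tube of one of the `L^{d−1}` face bonds
of `B` (`n` levels up); that face bond is unique (`eq_of_mem_tube`). [cite: Balaban1987RG1, (0.3) p.252] -/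
theorem mem_tube_succ_iff (n : ℕ) (hn : n + 1 ≤ P.m + P.K) (B : PBond P (n + 1)) (ℓ : PBond P 0) :
    (ℓ.dir = B.dir ∧ blockIter (n + 1) ℓ.src = B.src ∧ blockIter (n + 1) ℓ.tgt = B.tgt) ↔
      ∃ b : PBond P n, (b.dir = B.dir ∧ blockOf b.src = B.src ∧ blockOf b.tgt = B.tgt) ∧
        (ℓ.dir = b.dir ∧ blockIter n ℓ.src = b.src ∧ blockIter n ℓ.tgt = b.tgt) := by
  constructor
  · rintro ⟨hd, hs, ht⟩
    have hcross : blockIter n ℓ.tgt = (blockIter n ℓ.src).shift ℓ.dir := by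
      apply blockIter_tgt_eq_shift_of_succ n hn ℓ
      rw [ht, hs, PBond.tgt, hd]
    refine ⟨⟨blockIter n ℓ.src, ℓ.dir⟩, ⟨hd, ?_, ?_⟩, ⟨rfl, rfl, hcross⟩⟩
    · rw [← blockIter_succ]; exact hs
    · show blockOf ((blockIter n ℓ.src).shift ℓ.dir) = B.tgt
      rw [← hcross, ← blockIter_succ, ht]
  · rintro ⟨b, ⟨hbd, hbs, hbt⟩, ⟨hd, hs, ht⟩⟩
    refine ⟨hd.trans hbd, ?_, ?_⟩
    · rw [blockIter_succ, hs, hbs]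
    · rw [blockIter_succ, ht, hbt]

/-- ★★ **SUMS OVER A TUBE, ONE LEVEL DOWN**: `Σ_{ℓ ∈ tube_{n+1}(B)} g ℓ = Σ_{b ∈ face(B)} Σ_{ℓ ∈ tube_n(b)} g ℓ` (the tube of `B` is the disjoint union
of the tubes of its face bonds). [cite: Balaban1987RG1, (0.3) p.252] -/
theorem sum_tube_succ {M : Type*} [AddCommMonoid M] (n : ℕ) (hn : n + 1 ≤ P.m + P.K) (B : PBond P (n + 1)) (g : PBond P 0 → M) :
    ∑ ℓ ∈ univ.filter (fun ℓ : PBond P 0 => ℓ.dir = B.dir ∧ blockIter (n + 1) ℓ.src = B.src ∧ blockIter (n + 1) ℓ.tgt = B.tgt), g ℓ =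
      ∑ b ∈ univ.filter (fun b : PBond P n => b.dir = B.dir ∧ blockOf b.src = B.src ∧ blockOf b.tgt = B.tgt),
        ∑ ℓ ∈ univ.filter (fun ℓ : PBond P 0 => ℓ.dir = b.dir ∧ blockIter n ℓ.src = b.src ∧ blockIter n ℓ.tgt = b.tgt), g ℓ := by
  classical
  have hmaps : ∀ ℓ ∈ univ.filter (fun ℓ : PBond P 0 => ℓ.dir = B.dir ∧ blockIter (n + 1) ℓ.src = B.src ∧ blockIter (n + 1) ℓ.tgt = B.tgt),
      (fun ℓ : PBond P 0 => (⟨blockIter n ℓ.src, ℓ.dir⟩ : PBond P n)) ℓ ∈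
        univ.filter (fun b : PBond P n => b.dir = B.dir ∧ blockOf b.src = B.src ∧ blockOf b.tgt = B.tgt) := by
    intro ℓ hℓ
    rw [mem_filter] at hℓ
    obtain ⟨b, hb, hℓb⟩ := (mem_tube_succ_iff n hn B ℓ).1 hℓ.2
    rw [eq_of_mem_tube hℓb] at hb
    exact mem_filter.2 ⟨mem_univ _, hb⟩
  rw [← Finset.sum_fiberwise_of_maps_to hmaps g]
  refine Finset.sum_congr rfl fun b hb => Finset.sum_congr ?_ fun _ _ => rfl
  rw [mem_filter] at hb
  ext ℓ
  simp only [mem_filter, mem_univ, true_and]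
  constructor
  · rintro ⟨hℓ, hπ⟩
    subst hπ
    refine ⟨rfl, rfl, ?_⟩
    apply blockIter_tgt_eq_shift_of_succ n hn ℓ
    rw [hℓ.2.2, hℓ.2.1, PBond.tgt, hℓ.1]
  · intro hℓb
    exact ⟨(mem_tube_succ_iff n hn B ℓ).2 ⟨b, hb.2, hℓb⟩, (eq_of_mem_tube hℓb).symm⟩

/-- ★★ **THE TUBE COUNT**: a bond `n` levels up has exactly `(L^{d−1})^n` finest bonds in its tube (`N²` leaves of the face forest at `d = 3`,
`N = L^n`). [cite: Balaban1987RG1, (0.3) p.252] -/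
theorem card_tube : ∀ (n : ℕ), n ≤ P.m + P.K → ∀ B : PBond P n,
    (univ.filter fun ℓ : PBond P 0 => ℓ.dir = B.dir ∧ blockIter n ℓ.src = B.src ∧ blockIter n ℓ.tgt = B.tgt).card =
      (P.L ^ (P.d - 1)) ^ n
  | 0, _, B => by
    rw [pow_zero, Finset.card_eq_one]
    refine ⟨B, ?_⟩
    ext ℓ
    simp only [mem_filter, mem_univ, true_and, mem_singleton, blockIter_zero]
    constructor
    · rintro ⟨hd, hs, -⟩
      cases ℓ; cases B; simp only at hd hs; subst hd; subst hs; rfl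
    · rintro rfl
      exact ⟨rfl, rfl, rfl⟩
  | n + 1, hn, B => by
    rw [card_eq_sum_ones, sum_tube_succ n hn B (fun _ => 1)]
    simp_rw [← card_eq_sum_ones]
    rw [Finset.sum_congr rfl (fun b _ => card_tube n (Nat.le_of_succ_le hn) b), sum_const, card_face hn B, smul_eq_mul, pow_succ,
      mul_comm]

/-! ## §4 All roots at once: the tubes are pairwise disjoint -/

/-- ★ **THE TUBES PARTITION THE CROSSING BONDS**: `Σ_{B} Σ_{ℓ ∈ tube_n(B)} g ℓ = Σ_{ℓ crossing a face n levels up} g ℓ`. [cite: Balaban1987RG1, (0.3) p.252] -/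
theorem sum_sum_tube_eq {M : Type*} [AddCommMonoid M] (n : ℕ) (g : PBond P 0 → M) :
    ∑ B : PBond P n, ∑ ℓ ∈ univ.filter (fun ℓ : PBond P 0 => ℓ.dir = B.dir ∧ blockIter n ℓ.src = B.src ∧ blockIter n ℓ.tgt = B.tgt), g ℓ =
      ∑ ℓ ∈ univ.filter (fun ℓ : PBond P 0 => blockIter n ℓ.tgt = (blockIter n ℓ.src).shift ℓ.dir), g ℓ := by
  classical
  rw [← Finset.sum_fiberwise_of_maps_to (t := (univ : Finset (PBond P n)))
    (g := fun ℓ : PBond P 0 => (⟨blockIter n ℓ.src, ℓ.dir⟩ : PBond P n)) (fun _ _ => mem_univ _) g]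
  refine Finset.sum_congr rfl fun B _ => Finset.sum_congr ?_ fun _ _ => rfl
  ext ℓ
  simp only [mem_filter, mem_univ, true_and]
  constructor
  · rintro ⟨hd, hs, ht⟩
    refine ⟨?_, ?_⟩
    · rw [ht, hs, hd]; rfl
    · rw [hs, hd]
  · rintro ⟨hcross, hπ⟩
    subst hπ
    exact ⟨rfl, rfl, hcross⟩

/-- `Σ_{B} Σ_{ℓ ∈ tube_n(B)} g ℓ ≤ Σ_ℓ g ℓ` for `g ≥ 0`. [cite: Balaban1987RG1, (0.3) p.252] -/
theorem sum_sum_tube_le (n : ℕ) (g : PBond P 0 → ℝ) (hg : ∀ ℓ, 0 ≤ g ℓ) :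
    ∑ B : PBond P n, ∑ ℓ ∈ univ.filter (fun ℓ : PBond P 0 => ℓ.dir = B.dir ∧ blockIter n ℓ.src = B.src ∧ blockIter n ℓ.tgt = B.tgt), g ℓ ≤
      ∑ ℓ : PBond P 0, g ℓ := by
  rw [sum_sum_tube_eq n g]
  exact Finset.sum_le_univ_sum_of_nonneg hg

end Summit.QuantumFields.YangMills.Theorems.FluctuationComparisonRegPrIntLS2BetaFaceTubeCounts
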